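import Literature.Geometry.Lorentzian.BogovskiiRayTransform
import Literature.Geometry.Lorentzian.BogovskiiPointwise
import Literature.Geometry.Lorentzian.CoordTraceReversal
import HarnessLib

/-!
# The frozen Calderón–Zygmund kernel of the second derivatives of `S_η`

(trunk G08 = T-LORENTZ; family `gr`; namespace `Literature.Geometry.Lorentzian.MaoOhTao`.)

Mao–Oh–Tao (arXiv:2308.13031), Lemma 2.3 (S3): `∂_k∂_l S_η f` is a singular integral whose kernel is the second
`z`-derivative of the classical kernel `Ψ_y(z) = zᵢzⱼ Q₂[η](z; y)` (`BogovskiiClassicalForm`, `BogovskiiRayTransform`).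
With the rule `∂_{z_k} Q_m[φ] = Q_{m+1}[∂_k φ]` (`pd_bogovskiiQ`) everything is explicit:

* `pd_classicalKernel_eq`: `∂_k Ψ = (δ_ik zⱼ + δ_jk zᵢ) Q₂[η] + zᵢzⱼ Q₃[∂_kη]` (`z ≠ 0`, `η ∈ C¹`);
* `pd_pd_classicalKernel_eq`: `∂_l∂_k Ψ = K₂` with
  `K₂ = (δ_ikδ_jl + δ_jkδ_il) Q₂[η] + (δ_ik zⱼ + δ_jk zᵢ) Q₃[∂_lη] + (δ_il zⱼ + δ_jl zᵢ) Q₃[∂_kη] + zᵢzⱼ Q₄[∂_l∂_kη]`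
  (`bogovskiiK2`, the **frozen CZ kernel**, `η ∈ C²`);
* `pd_bogovskiiK2_eq`: the gradient of `K₂` (`η ∈ C³`);
* sizes for base points `|y| ≤ ρ`, `D = (R + ρ)₊`, `M` a bound for `η` and its partials up to order three:
  `|K₂| ≤ M(4D³ + 8D⁴ + 2D⁵)/|z|³` (`abs_bogovskiiK2_le`), `|∂_n K₂| ≤ M(12D⁴ + 12D⁵ + 2D⁶)/|z|⁴`
  (`abs_pd_bogovskiiK2_le`, `norm_fderiv_bogovskiiK2_le`), the Lipschitz bound in the base point
  `|K₂(z; y₁) − K₂(z; y₂)| ≤ 3M|y₁ − y₂|(4D³ + 8D⁴ + 2D⁵)/|z|³` (`abs_bogovskiiK2_sub_le`);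
* `K₂ = 0` for `|z| > (R + |y|)₊`, differentiability and continuity off the origin, joint measurability in `(z, y)`.

These are exactly the inputs of `Literature.Analysis.SingularIntegrals.eLpNorm_truncate_convolution_le` (degree `−3`
kernel with a degree `−2` primitive `∂_kΨ`), uniformly in the base point.

## References

* Y. Mao, S.-J. Oh, T. Tao, arXiv:2308.13031 (2023), Lemma 2.3, pp. 8–9 (key `MaoOhTao2023`).
-/

noncomputable section

open scoped RealInnerProductSpace Topology
open Filter MeasureTheory Set Metric Function

namespace Literature.Geometry.Lorentzian

namespace MaoOhTao

section SecondDerivative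

variable {η : E3 → ℝ} {R : ℝ}

/-- `∂_k Q_m[φ] = Q_{m+1}[∂_k φ]` off the origin (coordinate form of `fderiv_bogovskiiQ_apply`). [folklore] -/
theorem pd_bogovskiiQ {φ : E3 → ℝ} (hφ : ContDiff ℝ 1 φ) (hR : ∀ z : E3, R < ‖z‖ → φ z = 0) (y : E3) (m : ℕ)
    (k : Fin 3) {z : E3} (hz : z ≠ 0) : pd k (bogovskiiQ φ y m) z = bogovskiiQ (pd k φ) y (m + 1) z := by
  simp only [pd]
  exact fderiv_bogovskiiQ_apply hφ hR y m hz (e k)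

/-- The ray transform of a `C^{n+1}` kernel's partial derivative: `∂_k φ ∈ C^n` and vanishes off `B̄_R`. [folklore] -/
theorem contDiff_pd_and_vanish {φ : E3 → ℝ} {n : ℕ} (hφ : ContDiff ℝ (n + 1) φ) (hR : ∀ z : E3, R < ‖z‖ → φ z = 0)
    (k : Fin 3) : ContDiff ℝ n (pd k φ) ∧ ∀ z : E3, R < ‖z‖ → pd k φ z = 0 :=
  ⟨contDiff_pd hφ k, fun z hz ↦ pd_eq_zero_of_norm_lt hR k z hz⟩

/-- **First `z`-derivative of the classical kernel** `Ψ = zᵢzⱼ Q₂[η]` off the origin: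
`∂_k Ψ = (δ_ik zⱼ + δ_jk zᵢ) Q₂[η] + zᵢzⱼ Q₃[∂_kη]`. [cite: MaoOhTao2023, Lemma 2.3] -/
theorem pd_classicalKernel_eq (hη : ContDiff ℝ 1 η) (hR : ∀ z : E3, R < ‖z‖ → η z = 0) (y : E3) (i j k : Fin 3)
    {z : E3} (hz : z ≠ 0) :
    pd k (fun z : E3 ↦ z i * z j * bogovskiiQ η y 2 z) z =
      ((if i = k then 1 else 0) * z j + (if j = k then 1 else 0) * z i) * bogovskiiQ η y 2 z +
        z i * z j * bogovskiiQ (pd k η) y 3 z := by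
  have hQ : DifferentiableAt ℝ (bogovskiiQ η y 2) z := differentiableAt_bogovskiiQ hη hR y 2 hz
  have hzi : DifferentiableAt ℝ (fun z : E3 ↦ z i) z := (EuclideanSpace.proj (𝕜 := ℝ) i).differentiableAt
  have hzj : DifferentiableAt ℝ (fun z : E3 ↦ z j) z := (EuclideanSpace.proj (𝕜 := ℝ) j).differentiableAt
  have h1 : pd k (fun z : E3 ↦ z i * z j * bogovskiiQ η y 2 z) z =
      pd k (fun z : E3 ↦ z i * z j) z * bogovskiiQ η y 2 z + z i * z j * pd k (bogovskiiQ η y 2) z :=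
    pd_mul (hzi.mul hzj) hQ
  rw [h1, pd_mul hzi hzj, pd_coord, pd_coord, pd_bogovskiiQ hη hR y 2 k hz]
  ring

/-- **Second `z`-derivative of the classical kernel** off the origin, for `η ∈ C²` vanishing off `B̄_R`:
`∂_l∂_k Ψ = (δ_ikδ_jl + δ_jkδ_il) Q₂[η] + (δ_ik zⱼ + δ_jk zᵢ) Q₃[∂_lη] + (δ_il zⱼ + δ_jl zᵢ) Q₃[∂_kη] + zᵢzⱼ Q₄[∂_l∂_kη]`.
[cite: MaoOhTao2023, Lemma 2.3] -/
theorem pd_pd_classicalKernel_eq (hη : ContDiff ℝ 2 η) (hR : ∀ z : E3, R < ‖z‖ → η z = 0) (y : E3) (i j k l : Fin 3)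
    {z : E3} (hz : z ≠ 0) :
    pd l (pd k (fun z : E3 ↦ z i * z j * bogovskiiQ η y 2 z)) z =
      ((if i = k then 1 else 0) * (if j = l then 1 else 0) + (if j = k then 1 else 0) * (if i = l then 1 else 0)) *
          bogovskiiQ η y 2 z +
        ((if i = k then 1 else 0) * z j + (if j = k then 1 else 0) * z i) * bogovskiiQ (pd l η) y 3 z +
        ((if i = l then 1 else 0) * z j + (if j = l then 1 else 0) * z i) * bogovskiiQ (pd k η) y 3 z +
        z i * z j * bogovskiiQ (pd l (pd k η)) y 4 z := by
  have h1 : ContDiff ℝ 1 η := hη.of_le (by norm_cast)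
  obtain ⟨hkη, hRk⟩ := contDiff_pd_and_vanish (n := 1) hη hR k
  -- `pd k Ψ` agrees with the first-derivative formula near `z`
  have hev : pd k (fun z : E3 ↦ z i * z j * bogovskiiQ η y 2 z) =ᶠ[𝓝 z] fun z ↦
      ((if i = k then 1 else 0) * z j + (if j = k then 1 else 0) * z i) * bogovskiiQ η y 2 z +
        z i * z j * bogovskiiQ (pd k η) y 3 z := by
    filter_upwards [isOpen_compl_singleton.mem_nhds hz] with w hw
    exact pd_classicalKernel_eq h1 hR y i j k hw
  rw [show pd l (pd k (fun z : E3 ↦ z i * z j * bogovskiiQ η y 2 z)) z =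
      pd l (fun z ↦ ((if i = k then 1 else 0) * z j + (if j = k then 1 else 0) * z i) * bogovskiiQ η y 2 z +
        z i * z j * bogovskiiQ (pd k η) y 3 z) z from by simp only [pd]; rw [hev.fderiv_eq]]
  have hQ2 : DifferentiableAt ℝ (bogovskiiQ η y 2) z := differentiableAt_bogovskiiQ h1 hR y 2 hz
  have hQ3 : DifferentiableAt ℝ (bogovskiiQ (pd k η) y 3) z := differentiableAt_bogovskiiQ hkη hRk y 3 hz
  have hzi : DifferentiableAt ℝ (fun z : E3 ↦ z i) z := (EuclideanSpace.proj (𝕜 := ℝ) i).differentiableAt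
  have hzj : DifferentiableAt ℝ (fun z : E3 ↦ z j) z := (EuclideanSpace.proj (𝕜 := ℝ) j).differentiableAt
  have dcj : DifferentiableAt ℝ (fun z : E3 ↦ (if i = k then (1 : ℝ) else 0) * z j) z := hzj.const_mul _
  have dci : DifferentiableAt ℝ (fun z : E3 ↦ (if j = k then (1 : ℝ) else 0) * z i) z := hzi.const_mul _
  have hlin : DifferentiableAt ℝ (fun z : E3 ↦ (if i = k then 1 else 0) * z j + (if j = k then 1 else 0) * z i) z :=
    dcj.add dci
  have dij : DifferentiableAt ℝ (fun z : E3 ↦ z i * z j) z := hzi.mul hzj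
  have dA : DifferentiableAt ℝ (fun z : E3 ↦ ((if i = k then 1 else 0) * z j + (if j = k then 1 else 0) * z i) *
      bogovskiiQ η y 2 z) z := hlin.mul hQ2
  have dB : DifferentiableAt ℝ (fun z : E3 ↦ z i * z j * bogovskiiQ (pd k η) y 3 z) z := dij.mul hQ3
  rw [pd_add dA dB, pd_mul hlin hQ2, pd_mul dij hQ3, pd_mul hzi hzj, pd_add dcj dci, pd_const_mul' _ hzj,
    pd_const_mul' _ hzi, pd_coord, pd_coord, pd_bogovskiiQ h1 hR y 2 l hz,
    pd_bogovskiiQ hkη hRk y 3 l hz]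
  ring

end SecondDerivative

section KernelCZ

variable {η : E3 → ℝ} {R : ℝ}

/-- The **frozen Calderón–Zygmund kernel of `S_η`**: the second `z`-derivative `∂_l∂_k(zᵢzⱼQ₂[η](z; y))` written out
(`pd_pd_classicalKernel_eq`), as a function of `z` for fixed base point `y`:
`K₂ = (δ_ikδ_jl + δ_jkδ_il) Q₂[η] + (δ_ik zⱼ + δ_jk zᵢ) Q₃[∂_lη] + (δ_il zⱼ + δ_jl zᵢ) Q₃[∂_kη] + zᵢzⱼ Q₄[∂_l∂_kη]`.
[cite: MaoOhTao2023, Lemma 2.3] -/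
def bogovskiiK2 (η : E3 → ℝ) (y : E3) (i j k l : Fin 3) (z : E3) : ℝ :=
  ((if i = k then 1 else 0) * (if j = l then 1 else 0) + (if j = k then 1 else 0) * (if i = l then 1 else 0)) *
      bogovskiiQ η y 2 z +
    ((if i = k then 1 else 0) * z j + (if j = k then 1 else 0) * z i) * bogovskiiQ (pd l η) y 3 z +
    ((if i = l then 1 else 0) * z j + (if j = l then 1 else 0) * z i) * bogovskiiQ (pd k η) y 3 z +
    z i * z j * bogovskiiQ (pd l (pd k η)) y 4 z

/-- `∂_l∂_k(zᵢzⱼQ₂[η]) = K₂` off the origin. [cite: MaoOhTao2023, Lemma 2.3] -/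
theorem pd_pd_classicalKernel_eq_bogovskiiK2 (hη : ContDiff ℝ 2 η) (hR : ∀ z : E3, R < ‖z‖ → η z = 0) (y : E3)
    (i j k l : Fin 3) {z : E3} (hz : z ≠ 0) :
    pd l (pd k (fun z : E3 ↦ z i * z j * bogovskiiQ η y 2 z)) z = bogovskiiK2 η y i j k l z :=
  pd_pd_classicalKernel_eq hη hR y i j k l hz

/-- Size of `Q_m[φ]` for base points in `B̄_ρ`: `|Q_m[φ](z; y)| ≤ 2 M D^{m+1}/|z|^{m+1}`, `D = (R + ρ)₊`. [folklore] -/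
theorem abs_bogovskiiQ_le_of_norm_le {φ : E3 → ℝ} (hφ : Continuous φ) (hR : ∀ z : E3, R < ‖z‖ → φ z = 0) {M : ℝ}
    (hM : ∀ w, |φ w| ≤ M) {ρ : ℝ} {y : E3} (hy : ‖y‖ ≤ ρ) (m : ℕ) {z : E3} (hz : z ≠ 0) :
    |bogovskiiQ φ y m z| ≤ 2 * M * (max (R + ρ) 0) ^ (m + 1) / ‖z‖ ^ (m + 1) := by
  have hn : 0 < ‖z‖ := norm_pos_iff.2 hz
  have hM0 : 0 ≤ M := (abs_nonneg _).trans (hM 0)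
  have hT : max (R + ‖y‖) 0 / ‖z‖ ≤ max (R + ρ) 0 / ‖z‖ :=
    div_le_div_of_nonneg_right (max_le_max (by linarith) le_rfl) hn.le
  have hT0 : 0 ≤ max (R + ‖y‖) 0 / ‖z‖ := div_nonneg (le_max_right _ _) hn.le
  calc |bogovskiiQ φ y m z| ≤ 2 * (max (R + ‖y‖) 0 / ‖z‖) * (M * (max (R + ‖y‖) 0 / ‖z‖) ^ m) :=
        abs_bogovskiiQ_le hφ hR hM y m hz
    _ ≤ 2 * (max (R + ρ) 0 / ‖z‖) * (M * (max (R + ρ) 0 / ‖z‖) ^ m) := by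
        gcongr
    _ = 2 * M * (max (R + ρ) 0) ^ (m + 1) / ‖z‖ ^ (m + 1) := by
        rw [div_pow, pow_succ, pow_succ]
        field_simp

/-- The linear coefficients are bounded by `2|z|`: `|δ_ik zⱼ + δ_jk zᵢ| ≤ 2|z|`. [folklore] -/
theorem abs_delta_coord_add_le (i j k : Fin 3) (z : E3) :
    |(if i = k then (1 : ℝ) else 0) * z j + (if j = k then 1 else 0) * z i| ≤ 2 * ‖z‖ := by
  have hi : |z i| ≤ ‖z‖ := by
    simpa using PiLp.norm_apply_le z i
  have hj : |z j| ≤ ‖z‖ := by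
    simpa using PiLp.norm_apply_le z j
  have h1 : |(if i = k then (1 : ℝ) else 0) * z j| ≤ ‖z‖ := by
    split_ifs <;> simp [hj]
  have h2 : |(if j = k then (1 : ℝ) else 0) * z i| ≤ ‖z‖ := by
    split_ifs <;> simp [hi]
  calc _ ≤ |(if i = k then (1 : ℝ) else 0) * z j| + |(if j = k then 1 else 0) * z i| := abs_add_le _ _
    _ ≤ ‖z‖ + ‖z‖ := add_le_add h1 h2
    _ = 2 * ‖z‖ := by ring

/-- **Size of the frozen kernel**: for `η ∈ C²` with `|η|, |∂η|, |∂²η| ≤ M` vanishing off `B̄_R`, `|y| ≤ ρ`, `z ≠ 0`,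
`|K₂(z)| ≤ M (4D³ + 8D⁴ + 2D⁵)/|z|³`, `D = (R + ρ)₊`. [cite: MaoOhTao2023, Lemma 2.3 (S3)] -/
theorem abs_bogovskiiK2_le (hη : ContDiff ℝ 2 η) (hR : ∀ z : E3, R < ‖z‖ → η z = 0) {M : ℝ}
    (hM0 : ∀ w, |η w| ≤ M) (hM1 : ∀ a w, |pd a η w| ≤ M) (hM2 : ∀ a b w, |pd a (pd b η) w| ≤ M)
    {ρ : ℝ} {y : E3} (hy : ‖y‖ ≤ ρ) (i j k l : Fin 3) {z : E3} (hz : z ≠ 0) :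
    |bogovskiiK2 η y i j k l z| ≤
      M * (4 * (max (R + ρ) 0) ^ 3 + 8 * (max (R + ρ) 0) ^ 4 + 2 * (max (R + ρ) 0) ^ 5) / ‖z‖ ^ 3 := by
  have hn : 0 < ‖z‖ := norm_pos_iff.2 hz
  have hMnn : 0 ≤ M := (abs_nonneg _).trans (hM0 0)
  set D : ℝ := max (R + ρ) 0 with hD
  have hD0 : 0 ≤ D := le_max_right _ _
  have h1 : ContDiff ℝ 1 η := hη.of_le (by norm_cast)
  obtain ⟨hkη, hRk⟩ := contDiff_pd_and_vanish (n := 1) hη hR k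
  obtain ⟨hlη, hRl⟩ := contDiff_pd_and_vanish (n := 1) hη hR l
  obtain ⟨hlkη, hRlk⟩ := contDiff_pd_and_vanish (n := 0) hkη hRk l
  have bQ2 : |bogovskiiQ η y 2 z| ≤ 2 * M * D ^ 3 / ‖z‖ ^ 3 :=
    abs_bogovskiiQ_le_of_norm_le hη.continuous hR hM0 hy 2 hz
  have bQ3l : |bogovskiiQ (pd l η) y 3 z| ≤ 2 * M * D ^ 4 / ‖z‖ ^ 4 :=
    abs_bogovskiiQ_le_of_norm_le hlη.continuous hRl (hM1 l) hy 3 hz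
  have bQ3k : |bogovskiiQ (pd k η) y 3 z| ≤ 2 * M * D ^ 4 / ‖z‖ ^ 4 :=
    abs_bogovskiiQ_le_of_norm_le hkη.continuous hRk (hM1 k) hy 3 hz
  have bQ4 : |bogovskiiQ (pd l (pd k η)) y 4 z| ≤ 2 * M * D ^ 5 / ‖z‖ ^ 5 :=
    abs_bogovskiiQ_le_of_norm_le hlkη.continuous hRlk (hM2 l k) hy 4 hz
  have bδ : |(if i = k then (1 : ℝ) else 0) * (if j = l then 1 else 0) +
      (if j = k then 1 else 0) * (if i = l then 1 else 0)| ≤ 2 := by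
    split_ifs <;> norm_num
  have bL1 := abs_delta_coord_add_le i j k z
  have bL2 := abs_delta_coord_add_le i j l z
  have bij : |z i * z j| ≤ ‖z‖ ^ 2 := by
    rw [abs_mul, sq]
    have hi : |z i| ≤ ‖z‖ := by simpa using PiLp.norm_apply_le z i
    have hj : |z j| ≤ ‖z‖ := by simpa using PiLp.norm_apply_le z j
    exact mul_le_mul hi hj (abs_nonneg _) (norm_nonneg _)
  rw [bogovskiiK2]
  calc _ ≤ |((if i = k then (1 : ℝ) else 0) * (if j = l then 1 else 0) +
          (if j = k then 1 else 0) * (if i = l then 1 else 0)) * bogovskiiQ η y 2 z| +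
        |((if i = k then 1 else 0) * z j + (if j = k then 1 else 0) * z i) * bogovskiiQ (pd l η) y 3 z| +
        |((if i = l then 1 else 0) * z j + (if j = l then 1 else 0) * z i) * bogovskiiQ (pd k η) y 3 z| +
        |z i * z j * bogovskiiQ (pd l (pd k η)) y 4 z| := by
          refine (abs_add_le _ _).trans (add_le_add ((abs_add_le _ _).trans (add_le_add (abs_add_le _ _) le_rfl)) le_rfl)
    _ ≤ 2 * (2 * M * D ^ 3 / ‖z‖ ^ 3) + 2 * ‖z‖ * (2 * M * D ^ 4 / ‖z‖ ^ 4) + 2 * ‖z‖ * (2 * M * D ^ 4 / ‖z‖ ^ 4) +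
        ‖z‖ ^ 2 * (2 * M * D ^ 5 / ‖z‖ ^ 5) := by
          rw [abs_mul, abs_mul, abs_mul, abs_mul]
          gcongr
    _ = M * (4 * D ^ 3 + 8 * D ^ 4 + 2 * D ^ 5) / ‖z‖ ^ 3 := by
          field_simp
          ring

/-- `K₂` vanishes for `|z| > (R + |y|)₊` (so for `|z| > (R + ρ)₊` when `|y| ≤ ρ`). [folklore] -/
theorem bogovskiiK2_eq_zero_of_lt (hR : ∀ z : E3, R < ‖z‖ → η z = 0) (y : E3) (i j k l : Fin 3) {z : E3}
    (hz : max (R + ‖y‖) 0 < ‖z‖) : bogovskiiK2 η y i j k l z = 0 := by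
  have hRk : ∀ z : E3, R < ‖z‖ → pd k η z = 0 := fun z hz ↦ pd_eq_zero_of_norm_lt hR k z hz
  have hRl : ∀ z : E3, R < ‖z‖ → pd l η z = 0 := fun z hz ↦ pd_eq_zero_of_norm_lt hR l z hz
  have hRlk : ∀ z : E3, R < ‖z‖ → pd l (pd k η) z = 0 := fun z hz ↦ pd_eq_zero_of_norm_lt hRk l z hz
  simp only [bogovskiiK2, bogovskiiQ_eq_zero_of_lt hR y 2 hz, bogovskiiQ_eq_zero_of_lt hRl y 3 hz,
    bogovskiiQ_eq_zero_of_lt hRk y 3 hz, bogovskiiQ_eq_zero_of_lt hRlk y 4 hz, mul_zero, add_zero]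

/-- `K₂` is differentiable off the origin (for `η ∈ C³`). [folklore] -/
theorem differentiableAt_bogovskiiK2 (hη : ContDiff ℝ 3 η) (hR : ∀ z : E3, R < ‖z‖ → η z = 0) (y : E3)
    (i j k l : Fin 3) {z : E3} (hz : z ≠ 0) : DifferentiableAt ℝ (bogovskiiK2 η y i j k l) z := by
  have h1 : ContDiff ℝ 1 η := hη.of_le (by norm_cast)
  obtain ⟨hkη, hRk⟩ := contDiff_pd_and_vanish (n := 2) hη hR k
  obtain ⟨hlη, hRl⟩ := contDiff_pd_and_vanish (n := 2) hη hR l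
  obtain ⟨hlkη, hRlk⟩ := contDiff_pd_and_vanish (n := 1) hkη hRk l
  have hQ2 := differentiableAt_bogovskiiQ h1 hR y 2 hz
  have hQ3l := differentiableAt_bogovskiiQ (hlη.of_le (by norm_cast)) hRl y 3 hz
  have hQ3k := differentiableAt_bogovskiiQ (hkη.of_le (by norm_cast)) hRk y 3 hz
  have hQ4 := differentiableAt_bogovskiiQ hlkη hRlk y 4 hz
  have hzi : DifferentiableAt ℝ (fun z : E3 ↦ z i) z := (EuclideanSpace.proj (𝕜 := ℝ) i).differentiableAt
  have hzj : DifferentiableAt ℝ (fun z : E3 ↦ z j) z := (EuclideanSpace.proj (𝕜 := ℝ) j).differentiableAt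
  unfold bogovskiiK2
  fun_prop

/-- `K₂` is continuous off the origin (for `η ∈ C³`). [folklore] -/
theorem continuousOn_bogovskiiK2 (hη : ContDiff ℝ 3 η) (hR : ∀ z : E3, R < ‖z‖ → η z = 0) (y : E3)
    (i j k l : Fin 3) : ContinuousOn (bogovskiiK2 η y i j k l) {0}ᶜ := fun _ hz ↦
  (differentiableAt_bogovskiiK2 hη hR y i j k l hz).continuousAt.continuousWithinAt

end KernelCZ

section KernelCZGradient

variable {η : E3 → ℝ} {R : ℝ}

/-- **Gradient of the frozen kernel** off the origin (for `η ∈ C³`):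
`∂_n K₂ = c Q₃[∂_nη] + (δ_ikδ_jn + δ_jkδ_in) Q₃[∂_lη] + L₁ Q₄[∂_n∂_lη] + (δ_ilδ_jn + δ_jlδ_in) Q₃[∂_kη] + L₂ Q₄[∂_n∂_kη]
 + (δ_in zⱼ + δ_jn zᵢ) Q₄[∂_l∂_kη] + zᵢzⱼ Q₅[∂_n∂_l∂_kη]`. [cite: MaoOhTao2023, Lemma 2.3] -/
theorem pd_bogovskiiK2_eq (hη : ContDiff ℝ 3 η) (hR : ∀ z : E3, R < ‖z‖ → η z = 0) (y : E3) (i j k l n : Fin 3)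
    {z : E3} (hz : z ≠ 0) :
    pd n (bogovskiiK2 η y i j k l) z =
      ((if i = k then 1 else 0) * (if j = l then 1 else 0) + (if j = k then 1 else 0) * (if i = l then 1 else 0)) *
          bogovskiiQ (pd n η) y 3 z +
        (((if i = k then 1 else 0) * (if j = n then 1 else 0) + (if j = k then 1 else 0) * (if i = n then 1 else 0)) *
            bogovskiiQ (pd l η) y 3 z +
          ((if i = k then 1 else 0) * z j + (if j = k then 1 else 0) * z i) * bogovskiiQ (pd n (pd l η)) y 4 z) +
        (((if i = l then 1 else 0) * (if j = n then 1 else 0) + (if j = l then 1 else 0) * (if i = n then 1 else 0)) *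
            bogovskiiQ (pd k η) y 3 z +
          ((if i = l then 1 else 0) * z j + (if j = l then 1 else 0) * z i) * bogovskiiQ (pd n (pd k η)) y 4 z) +
        (((if i = n then 1 else 0) * z j + (if j = n then 1 else 0) * z i) * bogovskiiQ (pd l (pd k η)) y 4 z +
          z i * z j * bogovskiiQ (pd n (pd l (pd k η))) y 5 z) := by
  have h1 : ContDiff ℝ 1 η := hη.of_le (by norm_cast)
  obtain ⟨hkη, hRk⟩ := contDiff_pd_and_vanish (n := 2) hη hR k
  obtain ⟨hlη, hRl⟩ := contDiff_pd_and_vanish (n := 2) hη hR l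
  obtain ⟨hlkη, hRlk⟩ := contDiff_pd_and_vanish (n := 1) hkη hRk l
  have hkη1 : ContDiff ℝ 1 (pd k η) := hkη.of_le (by norm_cast)
  have hlη1 : ContDiff ℝ 1 (pd l η) := hlη.of_le (by norm_cast)
  have hQ2 := differentiableAt_bogovskiiQ h1 hR y 2 hz
  have hQ3l := differentiableAt_bogovskiiQ hlη1 hRl y 3 hz
  have hQ3k := differentiableAt_bogovskiiQ hkη1 hRk y 3 hz
  have hQ4 := differentiableAt_bogovskiiQ hlkη hRlk y 4 hz
  have hzi : DifferentiableAt ℝ (fun z : E3 ↦ z i) z := (EuclideanSpace.proj (𝕜 := ℝ) i).differentiableAt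
  have hzj : DifferentiableAt ℝ (fun z : E3 ↦ z j) z := (EuclideanSpace.proj (𝕜 := ℝ) j).differentiableAt
  -- the four summands of `K₂` and their differentiability
  have dL1a : DifferentiableAt ℝ (fun z : E3 ↦ (if i = k then (1 : ℝ) else 0) * z j) z := hzj.const_mul _
  have dL1b : DifferentiableAt ℝ (fun z : E3 ↦ (if j = k then (1 : ℝ) else 0) * z i) z := hzi.const_mul _
  have dL1 : DifferentiableAt ℝ (fun z : E3 ↦ (if i = k then (1 : ℝ) else 0) * z j + (if j = k then 1 else 0) * z i) z :=
    dL1a.add dL1b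
  have dL2a : DifferentiableAt ℝ (fun z : E3 ↦ (if i = l then (1 : ℝ) else 0) * z j) z := hzj.const_mul _
  have dL2b : DifferentiableAt ℝ (fun z : E3 ↦ (if j = l then (1 : ℝ) else 0) * z i) z := hzi.const_mul _
  have dL2 : DifferentiableAt ℝ (fun z : E3 ↦ (if i = l then (1 : ℝ) else 0) * z j + (if j = l then 1 else 0) * z i) z :=
    dL2a.add dL2b
  have dP : DifferentiableAt ℝ (fun z : E3 ↦ z i * z j) z := hzi.mul hzj
  have dT1 : DifferentiableAt ℝ (fun z : E3 ↦ ((if i = k then (1 : ℝ) else 0) * (if j = l then 1 else 0) +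
      (if j = k then 1 else 0) * (if i = l then 1 else 0)) * bogovskiiQ η y 2 z) z := hQ2.const_mul _
  have dT2 : DifferentiableAt ℝ (fun z : E3 ↦ ((if i = k then (1 : ℝ) else 0) * z j + (if j = k then 1 else 0) * z i) *
      bogovskiiQ (pd l η) y 3 z) z := dL1.mul hQ3l
  have dT3 : DifferentiableAt ℝ (fun z : E3 ↦ ((if i = l then (1 : ℝ) else 0) * z j + (if j = l then 1 else 0) * z i) *
      bogovskiiQ (pd k η) y 3 z) z := dL2.mul hQ3k
  have dT4 : DifferentiableAt ℝ (fun z : E3 ↦ z i * z j * bogovskiiQ (pd l (pd k η)) y 4 z) z := dP.mul hQ4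
  have dT12 : DifferentiableAt ℝ (fun z : E3 ↦ ((if i = k then (1 : ℝ) else 0) * (if j = l then 1 else 0) +
      (if j = k then 1 else 0) * (if i = l then 1 else 0)) * bogovskiiQ η y 2 z +
      ((if i = k then (1 : ℝ) else 0) * z j + (if j = k then 1 else 0) * z i) * bogovskiiQ (pd l η) y 3 z) z := dT1.add dT2
  have dT123 : DifferentiableAt ℝ (fun z : E3 ↦ ((if i = k then (1 : ℝ) else 0) * (if j = l then 1 else 0) +
      (if j = k then 1 else 0) * (if i = l then 1 else 0)) * bogovskiiQ η y 2 z +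
      ((if i = k then (1 : ℝ) else 0) * z j + (if j = k then 1 else 0) * z i) * bogovskiiQ (pd l η) y 3 z +
      ((if i = l then (1 : ℝ) else 0) * z j + (if j = l then 1 else 0) * z i) * bogovskiiQ (pd k η) y 3 z) z :=
    dT12.add dT3
  have hK : bogovskiiK2 η y i j k l = fun z ↦ ((if i = k then (1 : ℝ) else 0) * (if j = l then 1 else 0) +
      (if j = k then 1 else 0) * (if i = l then 1 else 0)) * bogovskiiQ η y 2 z +
      ((if i = k then (1 : ℝ) else 0) * z j + (if j = k then 1 else 0) * z i) * bogovskiiQ (pd l η) y 3 z +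
      ((if i = l then (1 : ℝ) else 0) * z j + (if j = l then 1 else 0) * z i) * bogovskiiQ (pd k η) y 3 z +
      z i * z j * bogovskiiQ (pd l (pd k η)) y 4 z := rfl
  rw [hK, pd_add dT123 dT4, pd_add dT12 dT3, pd_add dT1 dT2, pd_const_mul' _ hQ2, pd_mul dL1 hQ3l, pd_mul dL2 hQ3k,
    pd_mul dP hQ4, pd_add dL1a dL1b, pd_add dL2a dL2b, pd_const_mul' _ hzj, pd_const_mul' _ hzi,
    pd_const_mul' _ hzj, pd_const_mul' _ hzi, pd_mul hzi hzj, pd_coord, pd_coord,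
    pd_bogovskiiQ h1 hR y 2 n hz, pd_bogovskiiQ hlη1 hRl y 3 n hz, pd_bogovskiiQ hkη1 hRk y 3 n hz,
    pd_bogovskiiQ hlkη hRlk y 4 n hz]
  ring

/-- **Size of the gradient of the frozen kernel**: for `η ∈ C³` with `|∂η|, |∂²η|, |∂³η| ≤ M` vanishing off `B̄_R`,
`|y| ≤ ρ`, `z ≠ 0`: `|∂_n K₂(z)| ≤ M (12D⁴ + 12D⁵ + 2D⁶)/|z|⁴`, `D = (R + ρ)₊`. [cite: MaoOhTao2023, Lemma 2.3 (S3)] -/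
theorem abs_pd_bogovskiiK2_le (hη : ContDiff ℝ 3 η) (hR : ∀ z : E3, R < ‖z‖ → η z = 0) {M : ℝ}
    (hM1 : ∀ a w, |pd a η w| ≤ M) (hM2 : ∀ a b w, |pd a (pd b η) w| ≤ M)
    (hM3 : ∀ a b c w, |pd a (pd b (pd c η)) w| ≤ M) {ρ : ℝ} {y : E3} (hy : ‖y‖ ≤ ρ) (i j k l n : Fin 3) {z : E3}
    (hz : z ≠ 0) :
    |pd n (bogovskiiK2 η y i j k l) z| ≤
      M * (12 * (max (R + ρ) 0) ^ 4 + 12 * (max (R + ρ) 0) ^ 5 + 2 * (max (R + ρ) 0) ^ 6) / ‖z‖ ^ 4 := by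
  have hn : 0 < ‖z‖ := norm_pos_iff.2 hz
  have hMnn : 0 ≤ M := (abs_nonneg _).trans (hM1 0 0)
  set D : ℝ := max (R + ρ) 0 with hD
  have hD0 : 0 ≤ D := le_max_right _ _
  obtain ⟨hkη, hRk⟩ := contDiff_pd_and_vanish (n := 2) hη hR k
  obtain ⟨hlη, hRl⟩ := contDiff_pd_and_vanish (n := 2) hη hR l
  obtain ⟨hnη, hRn⟩ := contDiff_pd_and_vanish (n := 2) hη hR n
  obtain ⟨hlkη, hRlk⟩ := contDiff_pd_and_vanish (n := 1) hkη hRk l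
  obtain ⟨hnlη, hRnl⟩ := contDiff_pd_and_vanish (n := 1) hlη hRl n
  obtain ⟨hnkη, hRnk⟩ := contDiff_pd_and_vanish (n := 1) hkη hRk n
  obtain ⟨hnlkη, hRnlk⟩ := contDiff_pd_and_vanish (n := 0) hlkη hRlk n
  have b3n : |bogovskiiQ (pd n η) y 3 z| ≤ 2 * M * D ^ 4 / ‖z‖ ^ 4 :=
    abs_bogovskiiQ_le_of_norm_le hnη.continuous hRn (hM1 n) hy 3 hz
  have b3l : |bogovskiiQ (pd l η) y 3 z| ≤ 2 * M * D ^ 4 / ‖z‖ ^ 4 :=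
    abs_bogovskiiQ_le_of_norm_le hlη.continuous hRl (hM1 l) hy 3 hz
  have b3k : |bogovskiiQ (pd k η) y 3 z| ≤ 2 * M * D ^ 4 / ‖z‖ ^ 4 :=
    abs_bogovskiiQ_le_of_norm_le hkη.continuous hRk (hM1 k) hy 3 hz
  have b4nl : |bogovskiiQ (pd n (pd l η)) y 4 z| ≤ 2 * M * D ^ 5 / ‖z‖ ^ 5 :=
    abs_bogovskiiQ_le_of_norm_le hnlη.continuous hRnl (hM2 n l) hy 4 hz
  have b4nk : |bogovskiiQ (pd n (pd k η)) y 4 z| ≤ 2 * M * D ^ 5 / ‖z‖ ^ 5 :=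
    abs_bogovskiiQ_le_of_norm_le hnkη.continuous hRnk (hM2 n k) hy 4 hz
  have b4lk : |bogovskiiQ (pd l (pd k η)) y 4 z| ≤ 2 * M * D ^ 5 / ‖z‖ ^ 5 :=
    abs_bogovskiiQ_le_of_norm_le hlkη.continuous hRlk (hM2 l k) hy 4 hz
  have b5 : |bogovskiiQ (pd n (pd l (pd k η))) y 5 z| ≤ 2 * M * D ^ 6 / ‖z‖ ^ 6 :=
    abs_bogovskiiQ_le_of_norm_le hnlkη.continuous hRnlk (hM3 n l k) hy 5 hz
  have bδ : ∀ a b c d : Fin 3, |(if i = a then (1 : ℝ) else 0) * (if j = b then 1 else 0) +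
      (if j = c then 1 else 0) * (if i = d then 1 else 0)| ≤ 2 := by
    intro a b c d; split_ifs <;> norm_num
  have bL := fun c ↦ abs_delta_coord_add_le i j c z
  have bij : |z i * z j| ≤ ‖z‖ ^ 2 := by
    rw [abs_mul, sq]
    have hi : |z i| ≤ ‖z‖ := by simpa using PiLp.norm_apply_le z i
    have hj : |z j| ≤ ‖z‖ := by simpa using PiLp.norm_apply_le z j
    exact mul_le_mul hi hj (abs_nonneg _) (norm_nonneg _)
  rw [pd_bogovskiiK2_eq hη hR y i j k l n hz]
  calc _ ≤ |((if i = k then (1 : ℝ) else 0) * (if j = l then 1 else 0) + (if j = k then 1 else 0) * (if i = l then 1 else 0)) *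
          bogovskiiQ (pd n η) y 3 z| +
        (|((if i = k then (1 : ℝ) else 0) * (if j = n then 1 else 0) + (if j = k then 1 else 0) * (if i = n then 1 else 0)) *
            bogovskiiQ (pd l η) y 3 z| +
          |((if i = k then (1 : ℝ) else 0) * z j + (if j = k then 1 else 0) * z i) * bogovskiiQ (pd n (pd l η)) y 4 z|) +
        (|((if i = l then (1 : ℝ) else 0) * (if j = n then 1 else 0) + (if j = l then 1 else 0) * (if i = n then 1 else 0)) *
            bogovskiiQ (pd k η) y 3 z| +
          |((if i = l then (1 : ℝ) else 0) * z j + (if j = l then 1 else 0) * z i) * bogovskiiQ (pd n (pd k η)) y 4 z|) +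
        (|((if i = n then (1 : ℝ) else 0) * z j + (if j = n then 1 else 0) * z i) * bogovskiiQ (pd l (pd k η)) y 4 z| +
          |z i * z j * bogovskiiQ (pd n (pd l (pd k η))) y 5 z|) := by
          refine (abs_add_le _ _).trans (add_le_add ((abs_add_le _ _).trans (add_le_add ((abs_add_le _ _).trans
            (add_le_add le_rfl (abs_add_le _ _))) (abs_add_le _ _))) (abs_add_le _ _))
    _ ≤ 2 * (2 * M * D ^ 4 / ‖z‖ ^ 4) +
        (2 * (2 * M * D ^ 4 / ‖z‖ ^ 4) + 2 * ‖z‖ * (2 * M * D ^ 5 / ‖z‖ ^ 5)) +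
        (2 * (2 * M * D ^ 4 / ‖z‖ ^ 4) + 2 * ‖z‖ * (2 * M * D ^ 5 / ‖z‖ ^ 5)) +
        (2 * ‖z‖ * (2 * M * D ^ 5 / ‖z‖ ^ 5) + ‖z‖ ^ 2 * (2 * M * D ^ 6 / ‖z‖ ^ 6)) := by
          simp only [abs_mul]
          gcongr
          · exact bδ k l k l
          · exact bδ k n k n
          · exact bL k
          · exact bδ l n l n
          · exact bL l
          · exact bL n
          · rw [← abs_mul]; exact bij
    _ = M * (12 * D ^ 4 + 12 * D ^ 5 + 2 * D ^ 6) / ‖z‖ ^ 4 := by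
          field_simp
          ring

/-- **Norm of the gradient**: `‖D K₂(z)‖ ≤ 3 M (12D⁴ + 12D⁵ + 2D⁶)/|z|⁴` (sum of the three partials).
[cite: MaoOhTao2023, Lemma 2.3 (S3)] -/
theorem norm_fderiv_bogovskiiK2_le (hη : ContDiff ℝ 3 η) (hR : ∀ z : E3, R < ‖z‖ → η z = 0) {M : ℝ}
    (hM1 : ∀ a w, |pd a η w| ≤ M) (hM2 : ∀ a b w, |pd a (pd b η) w| ≤ M)
    (hM3 : ∀ a b c w, |pd a (pd b (pd c η)) w| ≤ M) {ρ : ℝ} {y : E3} (hy : ‖y‖ ≤ ρ) (i j k l : Fin 3) {z : E3}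
    (hz : z ≠ 0) :
    ‖fderiv ℝ (bogovskiiK2 η y i j k l) z‖ ≤
      3 * (M * (12 * (max (R + ρ) 0) ^ 4 + 12 * (max (R + ρ) 0) ^ 5 + 2 * (max (R + ρ) 0) ^ 6) / ‖z‖ ^ 4) := by
  rw [fderiv_eq_sum_pd]
  calc ‖∑ m, pd m (bogovskiiK2 η y i j k l) z • (EuclideanSpace.proj m : E3 →L[ℝ] ℝ)‖
      ≤ ∑ m, ‖pd m (bogovskiiK2 η y i j k l) z • (EuclideanSpace.proj m : E3 →L[ℝ] ℝ)‖ := norm_sum_le _ _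
    _ ≤ ∑ _m : Fin 3, M * (12 * (max (R + ρ) 0) ^ 4 + 12 * (max (R + ρ) 0) ^ 5 + 2 * (max (R + ρ) 0) ^ 6) / ‖z‖ ^ 4 := by
        refine Finset.sum_le_sum fun m _ ↦ ?_
        rw [norm_smul, Real.norm_eq_abs]
        calc |pd m (bogovskiiK2 η y i j k l) z| * ‖(EuclideanSpace.proj m : E3 →L[ℝ] ℝ)‖
            ≤ |pd m (bogovskiiK2 η y i j k l) z| * 1 := by
              gcongr
              refine ContinuousLinearMap.opNorm_le_bound _ zero_le_one fun v ↦ ?_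
              rw [one_mul]
              simpa using PiLp.norm_apply_le v m
          _ ≤ _ := by rw [mul_one]; exact abs_pd_bogovskiiK2_le hη hR hM1 hM2 hM3 hy i j k l m hz
    _ = _ := by simp [Finset.sum_const, Finset.card_univ, Fintype.card_fin]

end KernelCZGradient

section KernelCZLipschitz

variable {η : E3 → ℝ} {R : ℝ}

/-- Lipschitz bound for `Q_m[φ]` in the base point, for base points in `B̄_ρ` (clean form):
`|Q_m[φ](z; y₁) − Q_m[φ](z; y₂)| ≤ 2 M' |y₁ − y₂| D^{m+1}/|z|^{m+1}`. [folklore] -/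
theorem abs_bogovskiiQ_sub_le_of_norm_le {φ : E3 → ℝ} (hφ : ContDiff ℝ 1 φ) (hR : ∀ z : E3, R < ‖z‖ → φ z = 0)
    {M' : ℝ} (hM' : ∀ w, ‖fderiv ℝ φ w‖ ≤ M') {ρ : ℝ} {y₁ y₂ : E3} (hy₁ : ‖y₁‖ ≤ ρ) (hy₂ : ‖y₂‖ ≤ ρ) (m : ℕ)
    {z : E3} (hz : z ≠ 0) :
    |bogovskiiQ φ y₁ m z - bogovskiiQ φ y₂ m z| ≤ 2 * (M' * ‖y₁ - y₂‖) * (max (R + ρ) 0) ^ (m + 1) / ‖z‖ ^ (m + 1) := by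
  have hn : 0 < ‖z‖ := norm_pos_iff.2 hz
  calc _ ≤ 2 * (max (R + ρ) 0 / ‖z‖) * (M' * ‖y₁ - y₂‖ * (max (R + ρ) 0 / ‖z‖) ^ m) :=
        abs_bogovskiiQ_sub_le hφ hR hM' hy₁ hy₂ m hz
    _ = _ := by rw [div_pow, pow_succ, pow_succ]; field_simp

/-- The operator norm of `Dφ` is bounded by the sum of the absolute partials. [folklore] -/
theorem norm_fderiv_le_sum_abs_pd (φ : E3 → ℝ) (w : E3) : ‖fderiv ℝ φ w‖ ≤ ∑ m, |pd m φ w| := by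
  rw [fderiv_eq_sum_pd]
  calc ‖∑ m, pd m φ w • (EuclideanSpace.proj m : E3 →L[ℝ] ℝ)‖ ≤ ∑ m, ‖pd m φ w • (EuclideanSpace.proj m : E3 →L[ℝ] ℝ)‖ :=
        norm_sum_le _ _
    _ ≤ ∑ m, |pd m φ w| := by
        refine Finset.sum_le_sum fun m _ ↦ ?_
        rw [norm_smul, Real.norm_eq_abs]
        calc |pd m φ w| * ‖(EuclideanSpace.proj m : E3 →L[ℝ] ℝ)‖ ≤ |pd m φ w| * 1 := by
              gcongr
              refine ContinuousLinearMap.opNorm_le_bound _ zero_le_one fun v ↦ ?_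
              rw [one_mul]
              simpa using PiLp.norm_apply_le v m
          _ = |pd m φ w| := mul_one _

/-- **Lipschitz bound of the frozen kernel in the base point**: for `η ∈ C³` with `|∂η|, |∂²η|, |∂³η| ≤ M`
vanishing off `B̄_R`, `|y₁|, |y₂| ≤ ρ`, `z ≠ 0`:
`|K₂(z; y₁) − K₂(z; y₂)| ≤ 3M |y₁ − y₂| (4D³ + 8D⁴ + 2D⁵)/|z|³`. [cite: MaoOhTao2023, Lemma 2.3 (S3)] -/
theorem abs_bogovskiiK2_sub_le (hη : ContDiff ℝ 3 η) (hR : ∀ z : E3, R < ‖z‖ → η z = 0) {M : ℝ}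
    (hM1 : ∀ a w, |pd a η w| ≤ M) (hM2 : ∀ a b w, |pd a (pd b η) w| ≤ M)
    (hM3 : ∀ a b c w, |pd a (pd b (pd c η)) w| ≤ M) {ρ : ℝ} {y₁ y₂ : E3} (hy₁ : ‖y₁‖ ≤ ρ) (hy₂ : ‖y₂‖ ≤ ρ)
    (i j k l : Fin 3) {z : E3} (hz : z ≠ 0) :
    |bogovskiiK2 η y₁ i j k l z - bogovskiiK2 η y₂ i j k l z| ≤
      3 * M * ‖y₁ - y₂‖ * (4 * (max (R + ρ) 0) ^ 3 + 8 * (max (R + ρ) 0) ^ 4 + 2 * (max (R + ρ) 0) ^ 5) / ‖z‖ ^ 3 := by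
  have hn : 0 < ‖z‖ := norm_pos_iff.2 hz
  have hMnn : 0 ≤ M := (abs_nonneg _).trans (hM1 0 0)
  set D : ℝ := max (R + ρ) 0 with hD
  have hD0 : 0 ≤ D := le_max_right _ _
  have h1 : ContDiff ℝ 1 η := hη.of_le (by norm_cast)
  obtain ⟨hkη, hRk⟩ := contDiff_pd_and_vanish (n := 2) hη hR k
  obtain ⟨hlη, hRl⟩ := contDiff_pd_and_vanish (n := 2) hη hR l
  obtain ⟨hlkη, hRlk⟩ := contDiff_pd_and_vanish (n := 1) hkη hRk l
  -- operator-norm bounds `‖D(·)‖ ≤ 3M` for `η`, `∂η`, `∂²η`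
  have nη : ∀ w, ‖fderiv ℝ η w‖ ≤ 3 * M := fun w ↦ (norm_fderiv_le_sum_abs_pd η w).trans (by
    calc ∑ m, |pd m η w| ≤ ∑ _m : Fin 3, M := Finset.sum_le_sum fun m _ ↦ hM1 m w
      _ = 3 * M := by simp)
  have nk : ∀ w, ‖fderiv ℝ (pd k η) w‖ ≤ 3 * M := fun w ↦ (norm_fderiv_le_sum_abs_pd _ w).trans (by
    calc ∑ m, |pd m (pd k η) w| ≤ ∑ _m : Fin 3, M := Finset.sum_le_sum fun m _ ↦ hM2 m k w
      _ = 3 * M := by simp)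
  have nl : ∀ w, ‖fderiv ℝ (pd l η) w‖ ≤ 3 * M := fun w ↦ (norm_fderiv_le_sum_abs_pd _ w).trans (by
    calc ∑ m, |pd m (pd l η) w| ≤ ∑ _m : Fin 3, M := Finset.sum_le_sum fun m _ ↦ hM2 m l w
      _ = 3 * M := by simp)
  have nlk : ∀ w, ‖fderiv ℝ (pd l (pd k η)) w‖ ≤ 3 * M := fun w ↦ (norm_fderiv_le_sum_abs_pd _ w).trans (by
    calc ∑ m, |pd m (pd l (pd k η)) w| ≤ ∑ _m : Fin 3, M := Finset.sum_le_sum fun m _ ↦ hM3 m l k w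
      _ = 3 * M := by simp)
  set δ : ℝ := ‖y₁ - y₂‖ with hδ
  have b2 : |bogovskiiQ η y₁ 2 z - bogovskiiQ η y₂ 2 z| ≤ 2 * (3 * M * δ) * D ^ 3 / ‖z‖ ^ 3 :=
    abs_bogovskiiQ_sub_le_of_norm_le h1 hR nη hy₁ hy₂ 2 hz
  have b3l : |bogovskiiQ (pd l η) y₁ 3 z - bogovskiiQ (pd l η) y₂ 3 z| ≤ 2 * (3 * M * δ) * D ^ 4 / ‖z‖ ^ 4 :=
    abs_bogovskiiQ_sub_le_of_norm_le (hlη.of_le (by norm_cast)) hRl nl hy₁ hy₂ 3 hz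
  have b3k : |bogovskiiQ (pd k η) y₁ 3 z - bogovskiiQ (pd k η) y₂ 3 z| ≤ 2 * (3 * M * δ) * D ^ 4 / ‖z‖ ^ 4 :=
    abs_bogovskiiQ_sub_le_of_norm_le (hkη.of_le (by norm_cast)) hRk nk hy₁ hy₂ 3 hz
  have b4 : |bogovskiiQ (pd l (pd k η)) y₁ 4 z - bogovskiiQ (pd l (pd k η)) y₂ 4 z| ≤
      2 * (3 * M * δ) * D ^ 5 / ‖z‖ ^ 5 :=
    abs_bogovskiiQ_sub_le_of_norm_le hlkη hRlk nlk hy₁ hy₂ 4 hz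
  have bδ : |(if i = k then (1 : ℝ) else 0) * (if j = l then 1 else 0) +
      (if j = k then 1 else 0) * (if i = l then 1 else 0)| ≤ 2 := by
    split_ifs <;> norm_num
  have bL1 := abs_delta_coord_add_le i j k z
  have bL2 := abs_delta_coord_add_le i j l z
  have bij : |z i * z j| ≤ ‖z‖ ^ 2 := by
    rw [abs_mul, sq]
    have hi : |z i| ≤ ‖z‖ := by simpa using PiLp.norm_apply_le z i
    have hj : |z j| ≤ ‖z‖ := by simpa using PiLp.norm_apply_le z j
    exact mul_le_mul hi hj (abs_nonneg _) (norm_nonneg _)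
  have hdiff : bogovskiiK2 η y₁ i j k l z - bogovskiiK2 η y₂ i j k l z =
      ((if i = k then 1 else 0) * (if j = l then 1 else 0) + (if j = k then 1 else 0) * (if i = l then 1 else 0)) *
          (bogovskiiQ η y₁ 2 z - bogovskiiQ η y₂ 2 z) +
        ((if i = k then 1 else 0) * z j + (if j = k then 1 else 0) * z i) *
          (bogovskiiQ (pd l η) y₁ 3 z - bogovskiiQ (pd l η) y₂ 3 z) +
        ((if i = l then 1 else 0) * z j + (if j = l then 1 else 0) * z i) *
          (bogovskiiQ (pd k η) y₁ 3 z - bogovskiiQ (pd k η) y₂ 3 z) +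
        z i * z j * (bogovskiiQ (pd l (pd k η)) y₁ 4 z - bogovskiiQ (pd l (pd k η)) y₂ 4 z) := by
    simp only [bogovskiiK2]; ring
  rw [hdiff]
  calc _ ≤ |((if i = k then (1 : ℝ) else 0) * (if j = l then 1 else 0) +
          (if j = k then 1 else 0) * (if i = l then 1 else 0)) * (bogovskiiQ η y₁ 2 z - bogovskiiQ η y₂ 2 z)| +
        |((if i = k then 1 else 0) * z j + (if j = k then 1 else 0) * z i) *
          (bogovskiiQ (pd l η) y₁ 3 z - bogovskiiQ (pd l η) y₂ 3 z)| +
        |((if i = l then 1 else 0) * z j + (if j = l then 1 else 0) * z i) *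
          (bogovskiiQ (pd k η) y₁ 3 z - bogovskiiQ (pd k η) y₂ 3 z)| +
        |z i * z j * (bogovskiiQ (pd l (pd k η)) y₁ 4 z - bogovskiiQ (pd l (pd k η)) y₂ 4 z)| := by
          refine (abs_add_le _ _).trans (add_le_add ((abs_add_le _ _).trans (add_le_add (abs_add_le _ _) le_rfl)) le_rfl)
    _ ≤ 2 * (2 * (3 * M * δ) * D ^ 3 / ‖z‖ ^ 3) + 2 * ‖z‖ * (2 * (3 * M * δ) * D ^ 4 / ‖z‖ ^ 4) +
        2 * ‖z‖ * (2 * (3 * M * δ) * D ^ 4 / ‖z‖ ^ 4) + ‖z‖ ^ 2 * (2 * (3 * M * δ) * D ^ 5 / ‖z‖ ^ 5) := by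
          rw [abs_mul, abs_mul, abs_mul, abs_mul]
          gcongr
    _ = 3 * M * δ * (4 * D ^ 3 + 8 * D ^ 4 + 2 * D ^ 5) / ‖z‖ ^ 3 := by
          field_simp
          ring

end KernelCZLipschitz

section KernelCZMeasurable

variable {η : E3 → ℝ} {R : ℝ}

/-- Joint measurability of `(z, y) ↦ Q_m[φ](z; y)` for continuous `φ`. [folklore] -/
theorem measurable_bogovskiiQ_uncurry {φ : E3 → ℝ} (hφ : Continuous φ) (m : ℕ) :
    Measurable fun p : E3 × E3 ↦ bogovskiiQ φ p.2 m p.1 := by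
  have hc : Continuous fun q : (E3 × E3) × ℝ ↦ φ (q.2 • q.1.1 + q.1.2) * q.2 ^ m :=
    (hφ.comp ((continuous_snd.smul (continuous_fst.comp continuous_fst)).add
      (continuous_snd.comp continuous_fst))).mul (continuous_snd.pow m)
  have h := hc.stronglyMeasurable.integral_prod_right' (ν := (volume : Measure ℝ).restrict (Ioi 1))
  exact h.measurable

/-- Joint measurability of `(z, y) ↦ K₂(z; y)` for `η ∈ C²`. [folklore] -/
theorem measurable_bogovskiiK2_uncurry (hη : ContDiff ℝ 2 η) (i j k l : Fin 3) :
    Measurable fun p : E3 × E3 ↦ bogovskiiK2 η p.2 i j k l p.1 := by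
  have hk : Continuous (pd k η) := (contDiff_pd (n := 1) hη k).continuous
  have hl : Continuous (pd l η) := (contDiff_pd (n := 1) hη l).continuous
  have hlk : Continuous (pd l (pd k η)) := (contDiff_pd (n := 0) (contDiff_pd (n := 1) hη k) l).continuous
  have mi : Measurable fun p : E3 × E3 ↦ p.1 i := (EuclideanSpace.proj (𝕜 := ℝ) i).continuous.measurable.comp
    measurable_fst
  have mj : Measurable fun p : E3 × E3 ↦ p.1 j := (EuclideanSpace.proj (𝕜 := ℝ) j).continuous.measurable.comp
    measurable_fst
  unfold bogovskiiK2
  exact ((((measurable_const.mul (measurable_bogovskiiQ_uncurry hη.continuous 2)).add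
    (((mj.const_mul _).add (mi.const_mul _)).mul (measurable_bogovskiiQ_uncurry hl 3))).add
    (((mj.const_mul _).add (mi.const_mul _)).mul (measurable_bogovskiiQ_uncurry hk 3))).add
    ((mi.mul mj).mul (measurable_bogovskiiQ_uncurry hlk 4)))

end KernelCZMeasurable

end MaoOhTao

end Literature.Geometry.Lorentzian
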